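import Literature.MathematicalPhysics.QuantumFieldTheory.Balaban1983to89.B13Sqrt27Accretive

/-!
# `Balaban1983to89.B13Sqrt27AccretiveAlmostLocal` — T. Bałaban, *Renormalization group approach to lattice gauge field
theories. II. Cluster expansions*, Commun. Math. Phys. **116** (1988) 1–22 [Balaban1988RG2Cluster], (2.7) p. 13 ∕ p. 15
∕ (2.16) p. 16, second companion of `B13Sqrt27Accretive` (p422202): the SAME theorems for EXPONENTIALLY LOCALISED
(«almost local») kernels instead of finite-range ones — the almost-local accretive Combes–Thomas bound, the
x-uniform resolvent family, the full-rate decay of `T^{−1/2}`, the (2.16)-type difference of two square roots, and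
the «G̃₃(x)» tilt by a nonnegative almost-local operator uniformly on `x ∈ [0, γ₁]`

statement-level skeleton of published theorems with citation tags; proofs where landed; nothing here is a claim about
the Yang–Mills mass gap

WHY THIS FILE.  `B13Sqrt27Accretive` ∕ `B13Sqrt27AccretiveSquare` assume RANGE ONE in an `ℕ`-valued pseudo-metric (the
shape of the tree's `Literature.Analysis.Matrix.accretive_combes_thomas`).  The operators of (2.14) — `Δ^{(k)}`,
`C*Δ_kC`, and the tilt `−½x‖χ*(QA + D̄μ(QA))‖²` of (2.7) — are NOT of finite range: they contain the propagators of
[13] and are only EXPONENTIALLY localised; print says exactly *"almost local"* (p. 13).  Here the locality hypothesis is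
the Combes–Thomas one of the tree's real lemma `B9SectEKernel.resolvent_decay_uniform`: `(e^{κd} − 1)`-WEIGHTED
absolute off-diagonal row and column sums `Σ_l ‖T_{il}‖(e^{κd(i,l)} − 1) ≤ ϱ ≤ m/2` for a real pseudo-metric `d ≥ 0`
— met by any kernel with `‖T_{il}‖ ≤ K e^{−κ₀ d(i,l)}` at some `κ < κ₀` on a geometry with summable volume growth.

CITATION HEADER (verbatim, p. 13 [PDF 13]): *"This term determines a nonnegative, bounded and almost local operator. The
integral yields the representation (3.185) [13], with the operator G̃₂ replaced by G̃₃(x), which is defined as G̃₂, but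
with this additional operator. The operator G̃₃(x) has the same properties as G̃₂, especially it can be expanded into a
generalized random walk expansion. This yields an expansion of the integral above, hence an expansion of (C^{(k)})^{1/2}
also."*; p. 15 [PDF 15]: *"the operators in it are not symmetric, and the second measure is complex … The general case
is handled by a perturbative argument."*; (2.16) p. 16: `|R₁(b, b′)| ≦ (O(1)e^{−⅓δ₀M} + O(α₀ + α₁)) exp(−½δ₀|b₋ − b′₋|)`.

WHAT IS REPRODUCED (cell `pub-ymgap`, D-0062 Track A, seat `dag-n10-b` g2; notation of `B13Sqrt27Accretive`:
`invSqrt T = (1/π)∫₀^∞ x^{−1/2}(x·1 + T)⁻¹dx`, accretivity `m·Σ|v_i|² ≤ Re Σ conj(v_i)(Tv)_i`):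
* §1 **`almostLocal_inverse_decay`** — `m`-accretive, weighted sums `≤ ϱ ≤ m/2` at rate `κ` ⟹ `T` invertible and
  `‖(T⁻¹)_{ij}‖ ≤ (4/m)·e^{−κ·d(i,j)}`.  Proof: conjugate by `diag(e^{κd(·,j)})`; the conjugation defect has plain
  row/column sums `≤ ϱ` (`|e^t − 1| ≤ e^{|t|} − 1`), so the conjugate is `m/2`-accretive (Schur) and its inverse has
  entries `≤ 4/m` by `B13Sqrt27Accretive.resolvent_bound_of_accretive`; undo the conjugation.
* §2 **`almostLocal_resolvent_decay`** — for EVERY real `x ≥ 0`: `‖((x·1 + T)⁻¹)_{ij}‖ ≤ (4/(m + x))·e^{−κ·d(i,j)}` (the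
  shift leaves the weighted OFF-diagonal sums unchanged): «G̃₃(x) has the same properties as G̃₂», resolvent reading,
  x-uniform.
* §3 **`norm_invSqrt_apply_le_almostLocal`** — `‖(T^{−1/2})_{ij}‖ ≤ (4/√m)·e^{−κ·d(i,j)}`: the square root inherits the
  rate `κ` exactly (`B13Sqrt27Accretive.norm_integrand_le`, `B13Sqrt27.integral_kernel_Ioi`).
* §4 `norm_mul_mul_apply_le_through_real` (triple localisation through a dominated weight, real metric) and
  **`norm_invSqrt_sub_apply_le_almostLocal`** — `‖(T^{−1/2} − T′^{−1/2})_{ij}‖ ≤ (16B·c_V²/(m√m))·e^{−θ′·D(i,j)}` from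
  `‖(T − T′)_{kl}‖ ≤ B·e^{−ρ·D(k,l)}` (`0 ≤ θ′ ≤ ρ`, `θ′ + η ≤ κ`, volume sums `c_V` at rate `η`).
* §5 **`almostLocal_tilted_inverse_decay`** — `P` with `Re⟨v,Pv⟩ ≥ 0` and weighted sums `≤ ϱ_P`, `ϱ_T + γ₁ϱ_P ≤ m/2`
  ⟹ for EVERY `x ∈ [0, γ₁]`: `‖((T + x·P)⁻¹)_{ij}‖ ≤ (4/m)·e^{−κ·d(i,j)}` (GAPS G-B13-05 (a) *"x-uniform constants"*, now
  for the printed ALMOST-LOCAL tilt).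
Holomorphy in the background (`B13Sqrt27Accretive.differentiableOn_invSqrt_apply`) and the square identity
(`B13Sqrt27AccretiveSquare.invSqrt_mul_invSqrt`) use accretivity only and apply unchanged.
HONEST SCOPE.  Finite-matrix theorems; nothing of Bałaban's operators constructed; whether HIS precisions meet the
weighted-sum hypothesis with k-uniform `(m, κ, ϱ)` is object-level content of [13] ∕ the pin; the σ-polydisc direction
of (2.16) (walks) untouched.  No definition, no instance, no
notation, no `sorry`, no named fact.  NOT continuum, NOT Clay.
-/

noncomputable section

open MeasureTheory Set Filter Topology Finset Metric
open scoped Matrix ComplexConjugate Real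

namespace Literature.MathematicalPhysics.QuantumFieldTheory.Balaban1983to89.B13Sqrt27AccretiveAlmostLocal

open Literature.MathematicalPhysics.QuantumFieldTheory.Balaban1983to89.B13Sqrt27
  (kernel kernel_nonneg integral_kernel_Ioi integrableOn_kernel_Ioi)
open Literature.MathematicalPhysics.QuantumFieldTheory.Balaban1983to89.B13Sqrt27Accretive

variable {n : Type*} [Fintype n] [DecidableEq n]

/-! ## §1. The ALMOST-LOCAL accretive Combes–Thomas bound (exponentially localised kernels, no finite range) -/

/-- `|e^t − 1| ≤ e^θ − 1` for `|t| ≤ θ`. [folklore] -/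
private theorem abs_exp_sub_one_le {t θ : ℝ} (h : |t| ≤ θ) : |Real.exp t - 1| ≤ Real.exp θ - 1 := by
  have ht := abs_le.1 h
  rw [abs_sub_le_iff]
  constructor
  · linarith [Real.exp_le_exp.2 ht.2]
  · have h3 : Real.exp (-θ) ≤ Real.exp t := Real.exp_le_exp.2 (by linarith)
    linarith [Real.add_one_le_exp θ, Real.add_one_le_exp (-θ)]

omit [DecidableEq n] in
/-- Schur bound for a form: absolute row and column sums `≤ p` give `|Re Σ conj(v_i)(Pv)_i| ≤ p·Σ|v_i|²`. [folklore] -/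
private theorem abs_re_form_le (P : Matrix n n ℂ) {p : ℝ} (hp : 0 ≤ p)
    (hrow : ∀ i, ∑ j, ‖P i j‖ ≤ p) (hcol : ∀ j, ∑ i, ‖P i j‖ ≤ p) (v : n → ℂ) :
    |(∑ i, star (v i) * (P *ᵥ v) i).re| ≤ p * ∑ i, ‖v i‖ ^ 2 := by
  set S : ℝ := ∑ i, ‖v i‖ ^ 2 with hS
  have hS0 : 0 ≤ S := Finset.sum_nonneg fun i _ => by positivity
  have h1 : |(∑ i, star (v i) * (P *ᵥ v) i).re| ≤ ‖star v ⬝ᵥ (P *ᵥ v)‖ :=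
    (Complex.abs_re_le_norm _).trans_eq rfl
  have h2 := Literature.Analysis.Matrix.norm_star_dotProduct_le_sqrt_mul_sqrt v (P *ᵥ v)
  have h3 := Literature.Analysis.Matrix.sum_norm_sq_mulVec_le_of_rowSum_le_of_colSum_le P hp hrow hcol v
  have h4 : Real.sqrt (∑ i, ‖(P *ᵥ v) i‖ ^ 2) ≤ p * Real.sqrt S := by
    rw [← Real.sqrt_sq hp, ← Real.sqrt_mul (sq_nonneg p)]
    exact Real.sqrt_le_sqrt (by nlinarith [h3])
  calc |(∑ i, star (v i) * (P *ᵥ v) i).re| ≤ Real.sqrt S * Real.sqrt (∑ i, ‖(P *ᵥ v) i‖ ^ 2) := h1.trans h2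
    _ ≤ Real.sqrt S * (p * Real.sqrt S) := mul_le_mul_of_nonneg_left h4 (Real.sqrt_nonneg _)
    _ = p * S := by rw [mul_left_comm, Real.mul_self_sqrt hS0]

omit [Fintype n] [DecidableEq n] in
/-- The conjugation defect is entrywise `≤ ‖A_{il}‖(e^{κd(i,l)} − 1)` for a `d`-Lipschitz weight `ρ`. [folklore] -/
private theorem norm_conj_sub_le (A : Matrix n n ℂ) {κ : ℝ} (hκ : 0 ≤ κ) (ρ : n → ℝ) (d : n → n → ℝ)
    (hρ : ∀ i l, |ρ i - ρ l| ≤ d i l) (i l : n) :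
    ‖((Matrix.of fun a b => (Real.exp (κ * (ρ a - ρ b)) : ℂ) * A a b) - A) i l‖ ≤ ‖A i l‖ * (Real.exp (κ * d i l) - 1) := by
  have h1 : ((Matrix.of fun a b => (Real.exp (κ * (ρ a - ρ b)) : ℂ) * A a b) - A) i l = ((Real.exp (κ * (ρ i - ρ l)) - 1 : ℝ) : ℂ) * A i l := by
    simp only [Matrix.sub_apply, Matrix.of_apply]
    push_cast
    ring
  rw [h1, norm_mul, Complex.norm_real, Real.norm_eq_abs, mul_comm]
  refine mul_le_mul_of_nonneg_left (abs_exp_sub_one_le ?_) (norm_nonneg _)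
  rw [abs_mul, abs_of_nonneg hκ]
  exact mul_le_mul_of_nonneg_left (hρ i l) hκ

omit [DecidableEq n] in
/-- The conjugated form: `Σ conj(v_i)((E A E⁻¹)v)_i = Σ conj(v_i)(Av)_i + Σ conj(v_i)((E A E⁻¹ − A)v)_i`. [folklore] -/
private theorem form_conj_eq (A : Matrix n n ℂ) (κ : ℝ) (ρ : n → ℝ) (v : n → ℂ) :
    (∑ i, star (v i) * ((Matrix.of fun a b => (Real.exp (κ * (ρ a - ρ b)) : ℂ) * A a b) *ᵥ v) i)
      = (∑ i, star (v i) * (A *ᵥ v) i) + ∑ i, star (v i) * (((Matrix.of fun a b => (Real.exp (κ * (ρ a - ρ b)) : ℂ) * A a b) - A) *ᵥ v) i := by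
  rw [← Finset.sum_add_distrib]
  refine Finset.sum_congr rfl fun i _ => ?_
  rw [Matrix.sub_mulVec, Pi.sub_apply]
  ring

omit [DecidableEq n] in
/-- **Accretivity survives the exponential conjugation up to the weighted off-diagonal mass**: if `A` is
`m`-accretive and its `(e^{κd} − 1)`-weighted absolute row and column sums are `≤ ϱ`, then `E A E⁻¹` is
`(m − ϱ)`-accretive. [folklore] -/
private theorem accretive_conj (A : Matrix n n ℂ) {m κ ϱ : ℝ} (hκ : 0 ≤ κ) (hϱ : 0 ≤ ϱ) (ρ : n → ℝ)
    (d : n → n → ℝ) (hρ : ∀ i l, |ρ i - ρ l| ≤ d i l)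
    (hacc : ∀ v : n → ℂ, m * ∑ i, ‖v i‖ ^ 2 ≤ (∑ i, star (v i) * (A *ᵥ v) i).re)
    (hrow : ∀ i, ∑ l, ‖A i l‖ * (Real.exp (κ * d i l) - 1) ≤ ϱ)
    (hcol : ∀ l, ∑ i, ‖A i l‖ * (Real.exp (κ * d i l) - 1) ≤ ϱ) (v : n → ℂ) :
    (m - ϱ) * ∑ i, ‖v i‖ ^ 2 ≤ (∑ i, star (v i) * ((Matrix.of fun a b => (Real.exp (κ * (ρ a - ρ b)) : ℂ) * A a b) *ᵥ v) i).re := by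
  have hrow' : ∀ i, ∑ l, ‖((Matrix.of fun a b => (Real.exp (κ * (ρ a - ρ b)) : ℂ) * A a b) - A) i l‖ ≤ ϱ := fun i =>
    (Finset.sum_le_sum fun l _ => norm_conj_sub_le A hκ ρ d hρ i l).trans (hrow i)
  have hcol' : ∀ l, ∑ i, ‖((Matrix.of fun a b => (Real.exp (κ * (ρ a - ρ b)) : ℂ) * A a b) - A) i l‖ ≤ ϱ := fun l =>
    (Finset.sum_le_sum fun i _ => norm_conj_sub_le A hκ ρ d hρ i l).trans (hcol l)
  have hbd := abs_re_form_le ((Matrix.of fun a b => (Real.exp (κ * (ρ a - ρ b)) : ℂ) * A a b) - A) hϱ hrow' hcol' v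
  rw [form_conj_eq, Complex.add_re]
  have h1 := hacc v
  have h2 := neg_le_of_abs_le hbd
  nlinarith [h1, h2]

/-- Undoing the conjugation on the inverse: `(A⁻¹)_{ij} = e^{−κ(ρ_i − ρ_j)}·((E A E⁻¹)⁻¹)_{ij}`. [folklore] -/
private theorem inv_apply_eq_conj_inv (A : Matrix n n ℂ) (κ : ℝ) (ρ : n → ℝ) (hA : IsUnit A.det) (i j : n) :
    A⁻¹ i j = (Real.exp (-(κ * (ρ i - ρ j))) : ℂ) * (Matrix.of fun a b => (Real.exp (κ * (ρ a - ρ b)) : ℂ) * A a b)⁻¹ i j := by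
  -- `conj A = E * A * E'` with the diagonal matrices `E = diag(e^{κρ})`, `E' = diag(e^{−κρ})`, `E' * E = 1 = E * E'`
  set E : Matrix n n ℂ := Matrix.diagonal fun i => (Real.exp (κ * ρ i) : ℂ) with hE
  set E' : Matrix n n ℂ := Matrix.diagonal fun i => (Real.exp (-(κ * ρ i)) : ℂ) with hE'
  have hEE' : E * E' = 1 := by
    rw [hE, hE', Matrix.diagonal_mul_diagonal, ← Matrix.diagonal_one]
    congr 1; funext i
    rw [← Complex.ofReal_mul, ← Real.exp_add, add_neg_cancel, Real.exp_zero, Complex.ofReal_one]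
  have hE'E : E' * E = 1 := by
    rw [hE, hE', Matrix.diagonal_mul_diagonal, ← Matrix.diagonal_one]
    congr 1; funext i
    rw [← Complex.ofReal_mul, ← Real.exp_add, neg_add_cancel, Real.exp_zero, Complex.ofReal_one]
  have hconj : (Matrix.of fun a b => (Real.exp (κ * (ρ a - ρ b)) : ℂ) * A a b) = E * A * E' := by
    ext a b
    simp only [Matrix.of_apply, hE, hE', Matrix.mul_apply, Matrix.diagonal_apply, mul_ite, mul_zero,
      ite_mul, zero_mul, Finset.sum_ite_eq, Finset.sum_ite_eq', Finset.mem_univ, if_true]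
    rw [mul_sub, Real.exp_sub, div_eq_mul_inv, ← Real.exp_neg]
    push_cast
    ring
  -- the inverse of the conjugate is the conjugate of the inverse
  have hinv : (Matrix.of fun a b => (Real.exp (κ * (ρ a - ρ b)) : ℂ) * A a b)⁻¹ = E * A⁻¹ * E' := by
    rw [hconj]
    refine Matrix.inv_eq_right_inv ?_
    calc E * A * E' * (E * A⁻¹ * E') = E * A * (E' * E) * A⁻¹ * E' := by
          simp only [Matrix.mul_assoc]
      _ = 1 := by rw [hE'E, Matrix.mul_one, Matrix.mul_assoc E A, Matrix.mul_nonsing_inv A hA, Matrix.mul_one, hEE']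
  rw [hinv]
  simp only [hE, hE', Matrix.mul_apply, Matrix.diagonal_apply, mul_ite, mul_zero, ite_mul, zero_mul,
    Finset.sum_ite_eq, Finset.sum_ite_eq', Finset.mem_univ, if_true]
  have h1 : Real.exp (-(κ * (ρ i - ρ j))) * Real.exp (κ * ρ i) * Real.exp (-(κ * ρ j)) = 1 := by
    rw [← Real.exp_add, ← Real.exp_add, ← Real.exp_zero]
    congr 1; ring
  calc A⁻¹ i j = ((Real.exp (-(κ * (ρ i - ρ j))) * Real.exp (κ * ρ i) * Real.exp (-(κ * ρ j)) : ℝ) : ℂ)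
        * A⁻¹ i j := by rw [h1]; push_cast; ring
    _ = (Real.exp (-(κ * (ρ i - ρ j))) : ℂ) * ((Real.exp (κ * ρ i) : ℂ) * A⁻¹ i j * (Real.exp (-(κ * ρ j)) : ℂ)) := by
        push_cast; ring

/-- **THE ALMOST-LOCAL ACCRETIVE COMBES–THOMAS BOUND** (print: the (2.14) operators are exponentially localised —
«almost local» — rather than of finite range).  Let `d ≥ 0` be a real pseudo-metric on the index set and
`A : Matrix n n ℂ` be `m`-ACCRETIVE (`m > 0`) with `(e^{κd} − 1)`-WEIGHTED absolute row and column sums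
`Σ_l ‖A_{il}‖(e^{κd(i,l)} − 1) ≤ ϱ ≤ m/2` (`κ ≥ 0`; the diagonal never counts).  Then `A` is invertible and
`‖(A⁻¹)_{ij}‖ ≤ (4/m)·e^{−κd(i,j)}`.  (Conjugate by `diag(e^{κd(·,j)})`: the conjugate is `m/2`-accretive, so its
inverse has entries `≤ 4/m` by `B13Sqrt27Accretive.resolvent_bound_of_accretive`; undo the conjugation.)
[cite: Balaban1988RG2Cluster, (2.7) p.13, p.15, (2.16) p.16] -/
theorem almostLocal_inverse_decay (d : n → n → ℝ) (hd0 : ∀ i, d i i = 0) (hds : ∀ i j, d i j = d j i)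
    (hdt : ∀ i j k, d i k ≤ d i j + d j k) (A : Matrix n n ℂ) {m κ ϱ : ℝ} (hm : 0 < m) (hκ : 0 ≤ κ)
    (hϱ : 0 ≤ ϱ) (hϱm : ϱ ≤ m / 2)
    (hacc : ∀ v : n → ℂ, m * ∑ i, ‖v i‖ ^ 2 ≤ (∑ i, star (v i) * (A *ᵥ v) i).re)
    (hrow : ∀ i, ∑ l, ‖A i l‖ * (Real.exp (κ * d i l) - 1) ≤ ϱ)
    (hcol : ∀ l, ∑ i, ‖A i l‖ * (Real.exp (κ * d i l) - 1) ≤ ϱ) :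
    IsUnit A.det ∧ ∀ i j, ‖A⁻¹ i j‖ ≤ 4 / m * Real.exp (-(κ * d i j)) := by
  have hA : IsUnit A.det := by
    have h := (resolvent_bound_of_accretive A hm hacc le_rfl).1
    rwa [Complex.ofReal_zero, zero_smul, zero_add] at h
  refine ⟨hA, fun i j => ?_⟩
  -- weight `ρ = d(·, j)`, which is `d`-Lipschitz
  have hρ : ∀ a b, |d a j - d b j| ≤ d a b := fun a b => by
    rw [abs_sub_le_iff]
    constructor
    · have := hdt a b j; linarith
    · have := hdt b a j; rw [hds b a] at this; linarith
  have hm2 : 0 < m / 2 := by linarith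
  have haccC : ∀ v : n → ℂ, m / 2 * ∑ i, ‖v i‖ ^ 2 ≤ (∑ i, star (v i) * ((Matrix.of fun a b => (Real.exp (κ * ((fun a => d a j) a - (fun a => d a j) b)) : ℂ) * A a b) *ᵥ v) i).re :=
    fun v => by
      have h := accretive_conj A hκ hϱ (fun a => d a j) d hρ hacc hrow hcol v
      have hS0 : 0 ≤ ∑ i, ‖v i‖ ^ 2 := Finset.sum_nonneg fun i _ => by positivity
      nlinarith [h, mul_le_mul_of_nonneg_right hϱm hS0]
  have hC := (resolvent_bound_of_accretive (Matrix.of fun a b => (Real.exp (κ * ((fun a => d a j) a - (fun a => d a j) b)) : ℂ) * A a b) hm2 haccC le_rfl)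
  rw [Complex.ofReal_zero, zero_smul, zero_add] at hC
  have hCij := hC.2 i j
  rw [add_zero] at hCij
  rw [inv_apply_eq_conj_inv A κ (fun a => d a j) hA i j, norm_mul, Complex.norm_real, Real.norm_eq_abs,
    abs_of_pos (Real.exp_pos _), hd0, sub_zero, mul_comm]
  calc ‖(Matrix.of fun a b => (Real.exp (κ * ((fun a => d a j) a - (fun a => d a j) b)) : ℂ) * A a b)⁻¹ i j‖ * Real.exp (-(κ * d i j))
      ≤ 2 / (m / 2) * Real.exp (-(κ * d i j)) := mul_le_mul_of_nonneg_right hCij (Real.exp_pos _).le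
    _ = 4 / m * Real.exp (-(κ * d i j)) := by
        have : m ≠ 0 := hm.ne'
        field_simp
        ring

/-! ## §2. «G̃₃(x) has the same properties as G̃₂», almost-local form: the resolvent family, x-UNIFORM -/

omit [Fintype n] in
/-- The spectral shift does not touch the weighted OFF-diagonal sums (the diagonal carries the weight
`e^{κ·0} − 1 = 0`). [folklore] -/
private theorem weighted_sum_shift (d : n → n → ℝ) (hd0 : ∀ i, d i i = 0) (T : Matrix n n ℂ) (x κ : ℝ)
    (i l : n) :
    ‖((x : ℂ) • (1 : Matrix n n ℂ) + T) i l‖ * (Real.exp (κ * d i l) - 1) = ‖T i l‖ * (Real.exp (κ * d i l) - 1) := by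
  by_cases hil : i = l
  · subst hil
    rw [hd0, mul_zero, Real.exp_zero, sub_self, mul_zero, mul_zero]
  · rw [Matrix.add_apply, Matrix.smul_apply, Matrix.one_apply_ne hil, smul_zero, zero_add]

/-- **x-UNIFORM ALMOST-LOCAL LOCALISATION OF THE RESOLVENT FAMILY**: under the hypotheses of
`almostLocal_inverse_decay` (`m`-accretive, weighted off-diagonal sums `≤ ϱ ≤ m/2` at rate `κ`), for EVERY real
`x ≥ 0` the kernel `x·1 + T` is invertible and `‖((x·1 + T)⁻¹)_{ij}‖ ≤ (4/(m + x))·e^{−κ·d(i,j)}` — the rate `κ` does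
not see `x`. [cite: Balaban1988RG2Cluster, (2.7) p.13, p.15] -/
theorem almostLocal_resolvent_decay (d : n → n → ℝ) (hd0 : ∀ i, d i i = 0) (hds : ∀ i j, d i j = d j i)
    (hdt : ∀ i j k, d i k ≤ d i j + d j k) (T : Matrix n n ℂ) {m κ ϱ : ℝ} (hm : 0 < m) (hκ : 0 ≤ κ)
    (hϱ : 0 ≤ ϱ) (hϱm : ϱ ≤ m / 2)
    (hacc : ∀ v : n → ℂ, m * ∑ i, ‖v i‖ ^ 2 ≤ (∑ i, star (v i) * (T *ᵥ v) i).re)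
    (hrow : ∀ i, ∑ l, ‖T i l‖ * (Real.exp (κ * d i l) - 1) ≤ ϱ)
    (hcol : ∀ l, ∑ i, ‖T i l‖ * (Real.exp (κ * d i l) - 1) ≤ ϱ) {x : ℝ} (hx : 0 ≤ x) :
    IsUnit ((x : ℂ) • (1 : Matrix n n ℂ) + T).det ∧
      ∀ i j, ‖((x : ℂ) • (1 : Matrix n n ℂ) + T)⁻¹ i j‖ ≤ 4 / (m + x) * Real.exp (-(κ * d i j)) := by
  have hmx : 0 < m + x := by linarith
  have hϱmx : ϱ ≤ (m + x) / 2 := hϱm.trans (by linarith)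
  refine almostLocal_inverse_decay d hd0 hds hdt _ hmx hκ hϱ hϱmx (accretive_add_smul_one hacc x) ?_ ?_
  · intro i
    rw [Finset.sum_congr rfl fun l _ => weighted_sum_shift d hd0 T x κ i l]
    exact hrow i
  · intro l
    rw [Finset.sum_congr rfl fun i _ => weighted_sum_shift d hd0 T x κ i l]
    exact hcol l

/-! ## §3. The square root of an almost-local accretive kernel: decay at the SAME rate -/

/-- **DECAY OF `T^{−1/2}` FOR AN ALMOST-LOCAL ACCRETIVE KERNEL**: `‖(T^{−1/2})_{ij}‖ ≤ (4/√m)·e^{−κ·d(i,j)}` under the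
hypotheses of `almostLocal_inverse_decay` — no finite range, the rate `κ` of the weighted sums is inherited exactly.
[cite: Balaban1988RG2Cluster, (2.7) p.13, p.15, (2.16) p.16] -/
theorem norm_invSqrt_apply_le_almostLocal (d : n → n → ℝ) (hd0 : ∀ i, d i i = 0) (hds : ∀ i j, d i j = d j i)
    (hdt : ∀ i j k, d i k ≤ d i j + d j k) (T : Matrix n n ℂ) {m κ ϱ : ℝ} (hm : 0 < m) (hκ : 0 ≤ κ)
    (hϱ : 0 ≤ ϱ) (hϱm : ϱ ≤ m / 2)
    (hacc : ∀ v : n → ℂ, m * ∑ i, ‖v i‖ ^ 2 ≤ (∑ i, star (v i) * (T *ᵥ v) i).re)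
    (hrow : ∀ i, ∑ l, ‖T i l‖ * (Real.exp (κ * d i l) - 1) ≤ ϱ)
    (hcol : ∀ l, ∑ i, ‖T i l‖ * (Real.exp (κ * d i l) - 1) ≤ ϱ) (i j : n) :
    ‖invSqrt T i j‖ ≤ 4 / Real.sqrt m * Real.exp (-(κ * d i j)) := by
  have hR := fun (x : ℝ) (hx : 0 ≤ x) =>
    almostLocal_resolvent_decay d hd0 hds hdt T hm hκ hϱ hϱm hacc hrow hcol hx
  set g : ℝ := 2 * Real.exp (-(κ * d i j)) with hg
  have hres : ∀ x : ℝ, 0 ≤ x → ‖((x : ℂ) • (1 : Matrix n n ℂ) + T)⁻¹ i j‖ ≤ 2 / (m + x) * g := fun x hx =>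
    ((hR x hx).2 i j).trans_eq (by rw [hg]; ring)
  have hptw : ∀ x ∈ Ioi (0 : ℝ),
      ‖(Real.sqrt x)⁻¹ • ((x : ℂ) • (1 : Matrix n n ℂ) + T)⁻¹ i j‖ ≤ 2 * g * kernel m x :=
    fun x hx => norm_integrand_le hres hx
  have hbound := norm_integral_le_of_norm_le ((integrableOn_kernel_Ioi hm).const_mul (2 * g))
    (ae_restrict_of_forall_mem measurableSet_Ioi hptw)
  rw [integral_const_mul, integral_kernel_Ioi hm] at hbound
  rw [invSqrt_apply, norm_smul, Real.norm_eq_abs, abs_of_pos (inv_pos.2 Real.pi_pos)]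
  calc π⁻¹ * ‖∫ x in Ioi (0 : ℝ), (Real.sqrt x)⁻¹ • ((x : ℂ) • (1 : Matrix n n ℂ) + T)⁻¹ i j‖
      ≤ π⁻¹ * (2 * g * (π / Real.sqrt m)) :=
        mul_le_mul_of_nonneg_left hbound (inv_pos.2 Real.pi_pos).le
    _ = 4 / Real.sqrt m * Real.exp (-(κ * d i j)) := by
        have hπ0 : (π : ℝ) ≠ 0 := Real.pi_ne_zero
        rw [hg]; field_simp; ring

/-! ## §4. The (2.16)-type difference of two almost-local square roots -/

omit [DecidableEq n] in
/-- Triple products localise through the middle factor (real pseudo-metric form of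
`B13Sqrt27Accretive.norm_mul_mul_apply_le_through`). [cite: Balaban1988RG2Cluster, (2.16) p.16] -/
theorem norm_mul_mul_apply_le_through_real (d : n → n → ℝ) (hdnn : ∀ i j, 0 ≤ d i j) (D : n → n → ℝ)
    (hD0 : ∀ k l, 0 ≤ D k l) (hD : ∀ i k l j, D i j ≤ d i k + D k l + d l j)
    {R E R' : Matrix n n ℂ} {a B a' θ ρ η θ' cV : ℝ} (ha : 0 ≤ a) (hB : 0 ≤ B) (ha' : 0 ≤ a')
    (hθ' : 0 ≤ θ') (hθρ : θ' ≤ ρ) (hθη : θ' + η ≤ θ)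
    (hR : ∀ i k, ‖R i k‖ ≤ a * Real.exp (-(θ * d i k)))
    (hE : ∀ k l, ‖E k l‖ ≤ B * Real.exp (-(ρ * D k l)))
    (hR' : ∀ l j, ‖R' l j‖ ≤ a' * Real.exp (-(θ * d l j)))
    (hvol : ∀ i, ∑ k, Real.exp (-(η * d i k)) ≤ cV) (hvol' : ∀ j, ∑ l, Real.exp (-(η * d l j)) ≤ cV)
    (i j : n) :
    ‖(R * E * R') i j‖ ≤ a * B * a' * cV ^ 2 * Real.exp (-(θ' * D i j)) := by
  have hcV : 0 ≤ cV := (Finset.sum_nonneg fun k _ => (Real.exp_pos _).le).trans (hvol i)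
  have hterm : ∀ k l, ‖R i k‖ * ‖E k l‖ * ‖R' l j‖ ≤
      a * B * a' * Real.exp (-(θ' * D i j)) * (Real.exp (-(η * d i k)) * Real.exp (-(η * d l j))) := by
    intro k l
    have h1 : Real.exp (-(θ * d i k)) ≤ Real.exp (-(θ' * d i k)) * Real.exp (-(η * d i k)) := by
      rw [← Real.exp_add]; apply Real.exp_le_exp.2
      have := hdnn i k
      nlinarith
    have h2 : Real.exp (-(ρ * D k l)) ≤ Real.exp (-(θ' * D k l)) :=
      Real.exp_le_exp.2 (neg_le_neg (mul_le_mul_of_nonneg_right hθρ (hD0 k l)))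
    have h3 : Real.exp (-(θ * d l j)) ≤ Real.exp (-(θ' * d l j)) * Real.exp (-(η * d l j)) := by
      rw [← Real.exp_add]; apply Real.exp_le_exp.2
      have := hdnn l j
      nlinarith
    have h4 : Real.exp (-(θ' * d i k)) * Real.exp (-(θ' * D k l)) * Real.exp (-(θ' * d l j))
        ≤ Real.exp (-(θ' * D i j)) := by
      rw [← Real.exp_add, ← Real.exp_add]; apply Real.exp_le_exp.2
      have := hD i k l j
      nlinarith
    calc ‖R i k‖ * ‖E k l‖ * ‖R' l j‖
        ≤ (a * Real.exp (-(θ * d i k))) * (B * Real.exp (-(ρ * D k l))) * (a' * Real.exp (-(θ * d l j))) :=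
          mul_le_mul (mul_le_mul (hR i k) (hE k l) (norm_nonneg _) (by positivity)) (hR' l j) (norm_nonneg _)
            (by positivity)
      _ ≤ (a * (Real.exp (-(θ' * d i k)) * Real.exp (-(η * d i k)))) * (B * Real.exp (-(θ' * D k l)))
            * (a' * (Real.exp (-(θ' * d l j)) * Real.exp (-(η * d l j)))) :=
          mul_le_mul (mul_le_mul (mul_le_mul_of_nonneg_left h1 ha) (mul_le_mul_of_nonneg_left h2 hB)
            (by positivity) (by positivity)) (mul_le_mul_of_nonneg_left h3 ha') (by positivity) (by positivity)
      _ = a * B * a' * (Real.exp (-(θ' * d i k)) * Real.exp (-(θ' * D k l)) * Real.exp (-(θ' * d l j)))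
            * (Real.exp (-(η * d i k)) * Real.exp (-(η * d l j))) := by ring
      _ ≤ a * B * a' * Real.exp (-(θ' * D i j)) * (Real.exp (-(η * d i k)) * Real.exp (-(η * d l j))) :=
          mul_le_mul_of_nonneg_right (mul_le_mul_of_nonneg_left h4 (by positivity)) (by positivity)
  calc ‖(R * E * R') i j‖ = ‖∑ l, (∑ k, R i k * E k l) * R' l j‖ := by
        simp only [Matrix.mul_apply, Finset.sum_mul]
    _ ≤ ∑ l, ∑ k, ‖R i k‖ * ‖E k l‖ * ‖R' l j‖ := by
        refine (norm_sum_le _ _).trans (Finset.sum_le_sum fun l _ => ?_)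
        rw [Finset.sum_mul]
        refine (norm_sum_le _ _).trans (Finset.sum_le_sum fun k _ => ?_)
        rw [norm_mul, norm_mul]
    _ ≤ ∑ l, ∑ k, a * B * a' * Real.exp (-(θ' * D i j)) *
          (Real.exp (-(η * d i k)) * Real.exp (-(η * d l j))) :=
        Finset.sum_le_sum fun l _ => Finset.sum_le_sum fun k _ => hterm k l
    _ = a * B * a' * Real.exp (-(θ' * D i j)) *
          ((∑ k, Real.exp (-(η * d i k))) * ∑ l, Real.exp (-(η * d l j))) := by
        rw [Finset.sum_mul_sum, Finset.sum_comm, Finset.mul_sum]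
        refine Finset.sum_congr rfl fun l _ => ?_
        rw [Finset.mul_sum]
    _ ≤ a * B * a' * Real.exp (-(θ' * D i j)) * (cV * cV) :=
        mul_le_mul_of_nonneg_left (mul_le_mul (hvol i) (hvol' j)
          (Finset.sum_nonneg fun l _ => (Real.exp_pos _).le) hcV) (by positivity)
    _ = a * B * a' * cV ^ 2 * Real.exp (-(θ' * D i j)) := by ring

/-- **THE (2.16)-TYPE DIFFERENCE OF TWO ALMOST-LOCAL SQUARE ROOTS**: two kernels `T, T′` both as in
`almostLocal_inverse_decay` (same `d`, `m`, `κ`, `ϱ`) with `‖(T − T′)_{kl}‖ ≤ B·e^{−ρ·D(k,l)}` for a non-negative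
weight `D` dominated through `d` have `‖(T^{−1/2} − T′^{−1/2})_{ij}‖ ≤ (16B·c_V²/(m√m))·e^{−θ′·D(i,j)}`
(`0 ≤ θ′ ≤ ρ`, `θ′ + η ≤ κ`, volume sums `c_V` at rate `η`). [cite: Balaban1988RG2Cluster, (2.16) p.16, (2.7) p.13] -/
theorem norm_invSqrt_sub_apply_le_almostLocal (d : n → n → ℝ) (hd0 : ∀ i, d i i = 0) (hds : ∀ i j, d i j = d j i)
    (hdt : ∀ i j k, d i k ≤ d i j + d j k) (hdnn : ∀ i j, 0 ≤ d i j) (T T' : Matrix n n ℂ) {m κ ϱ : ℝ}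
    (hm : 0 < m) (hκ : 0 ≤ κ) (hϱ : 0 ≤ ϱ) (hϱm : ϱ ≤ m / 2)
    (hacc : ∀ v : n → ℂ, m * ∑ i, ‖v i‖ ^ 2 ≤ (∑ i, star (v i) * (T *ᵥ v) i).re)
    (hacc' : ∀ v : n → ℂ, m * ∑ i, ‖v i‖ ^ 2 ≤ (∑ i, star (v i) * (T' *ᵥ v) i).re)
    (hrow : ∀ i, ∑ l, ‖T i l‖ * (Real.exp (κ * d i l) - 1) ≤ ϱ)
    (hcol : ∀ l, ∑ i, ‖T i l‖ * (Real.exp (κ * d i l) - 1) ≤ ϱ)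
    (hrow' : ∀ i, ∑ l, ‖T' i l‖ * (Real.exp (κ * d i l) - 1) ≤ ϱ)
    (hcol' : ∀ l, ∑ i, ‖T' i l‖ * (Real.exp (κ * d i l) - 1) ≤ ϱ)
    (D : n → n → ℝ) (hD0 : ∀ k l, 0 ≤ D k l) (hD : ∀ i k l j, D i j ≤ d i k + D k l + d l j)
    {B ρ η θ' cV : ℝ} (hB : 0 ≤ B) (hθ' : 0 ≤ θ') (hθρ : θ' ≤ ρ) (hθη : θ' + η ≤ κ)
    (hE : ∀ k l, ‖(T - T') k l‖ ≤ B * Real.exp (-(ρ * D k l)))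
    (hvol : ∀ i, ∑ k, Real.exp (-(η * d i k)) ≤ cV) (hvol' : ∀ j, ∑ l, Real.exp (-(η * d l j)) ≤ cV)
    (i j : n) :
    ‖(invSqrt T - invSqrt T') i j‖ ≤ 16 * B * cV ^ 2 / (m * Real.sqrt m) * Real.exp (-(θ' * D i j)) := by
  have hR := fun (x : ℝ) (hx : 0 ≤ x) =>
    almostLocal_resolvent_decay d hd0 hds hdt T hm hκ hϱ hϱm hacc hrow hcol hx
  have hR' := fun (x : ℝ) (hx : 0 ≤ x) =>
    almostLocal_resolvent_decay d hd0 hds hdt T' hm hκ hϱ hϱm hacc' hrow' hcol' hx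
  have hI := integrableOn_integrand T hm hacc i j
  have hI' := integrableOn_integrand T' hm hacc' i j
  set g : ℝ := Real.exp (-(θ' * D i j)) with hg
  have hptw : ∀ x ∈ Ioi (0 : ℝ),
      ‖(Real.sqrt x)⁻¹ • ((x : ℂ) • (1 : Matrix n n ℂ) + T)⁻¹ i j
        - (Real.sqrt x)⁻¹ • ((x : ℂ) • (1 : Matrix n n ℂ) + T')⁻¹ i j‖
        ≤ 16 * B * cV ^ 2 / m * g * kernel m x := by
    intro x hx
    have hx0 : (0 : ℝ) < x := hx
    have hu : IsUnit ((x : ℂ) • (1 : Matrix n n ℂ) + T) :=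
      (Matrix.isUnit_iff_isUnit_det _).2 (hR x hx0.le).1
    have hu' : IsUnit ((x : ℂ) • (1 : Matrix n n ℂ) + T') :=
      (Matrix.isUnit_iff_isUnit_det _).2 (hR' x hx0.le).1
    have hdiff : ((x : ℂ) • (1 : Matrix n n ℂ) + T)⁻¹ - ((x : ℂ) • (1 : Matrix n n ℂ) + T')⁻¹
        = ((x : ℂ) • (1 : Matrix n n ℂ) + T)⁻¹ * (T' - T) * ((x : ℂ) • (1 : Matrix n n ℂ) + T')⁻¹ := by
      rw [Matrix.inv_sub_inv (iff_of_true hu hu')]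
      congr 2
      abel
    have hE' : ∀ k l, ‖(T' - T) k l‖ ≤ B * Real.exp (-(ρ * D k l)) := fun k l => by
      rw [← norm_neg, ← Matrix.neg_apply, neg_sub]; exact hE k l
    have hmx : 0 < m + x := by linarith
    have htriple := norm_mul_mul_apply_le_through_real d hdnn D hD0 hD (by positivity) hB (by positivity)
      hθ' hθρ hθη (hR x hx0.le).2 hE' (hR' x hx0.le).2 hvol hvol' i j
    rw [← smul_sub, ← Matrix.sub_apply, hdiff, norm_smul, Real.norm_eq_abs,
      abs_of_nonneg (inv_nonneg.2 (Real.sqrt_nonneg x)), kernel]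
    have hs : 0 ≤ (Real.sqrt x)⁻¹ := inv_nonneg.2 (Real.sqrt_nonneg x)
    have hcV : 0 ≤ cV := (Finset.sum_nonneg fun k _ => (Real.exp_pos _).le).trans (hvol i)
    calc (Real.sqrt x)⁻¹ * ‖(((x : ℂ) • (1 : Matrix n n ℂ) + T)⁻¹ * (T' - T) *
            ((x : ℂ) • (1 : Matrix n n ℂ) + T')⁻¹) i j‖
        ≤ (Real.sqrt x)⁻¹ * (4 / (m + x) * B * (4 / (m + x)) * cV ^ 2 * g) :=
          mul_le_mul_of_nonneg_left htriple hs
      _ ≤ (Real.sqrt x)⁻¹ * (4 / (m + x) * B * (4 / m) * cV ^ 2 * g) := by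
          gcongr
          linarith
      _ = 16 * B * cV ^ 2 / m * g * ((Real.sqrt x)⁻¹ * (x + m)⁻¹) := by
          rw [add_comm m x]; field_simp; ring
  have hbound := norm_integral_le_of_norm_le
    ((integrableOn_kernel_Ioi hm).const_mul (16 * B * cV ^ 2 / m * g))
    (ae_restrict_of_forall_mem measurableSet_Ioi hptw)
  rw [integral_const_mul, integral_kernel_Ioi hm] at hbound
  rw [Matrix.sub_apply, invSqrt_apply, invSqrt_apply, ← smul_sub, ← integral_sub hI hI', norm_smul,
    Real.norm_eq_abs, abs_of_pos (inv_pos.2 Real.pi_pos)]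
  calc π⁻¹ * ‖∫ x in Ioi (0 : ℝ), ((Real.sqrt x)⁻¹ • ((x : ℂ) • (1 : Matrix n n ℂ) + T)⁻¹ i j
          - (Real.sqrt x)⁻¹ • ((x : ℂ) • (1 : Matrix n n ℂ) + T')⁻¹ i j)‖
      ≤ π⁻¹ * (16 * B * cV ^ 2 / m * g * (π / Real.sqrt m)) :=
        mul_le_mul_of_nonneg_left hbound (inv_pos.2 Real.pi_pos).le
    _ = 16 * B * cV ^ 2 / (m * Real.sqrt m) * g := by
        have hπ0 : (π : ℝ) ≠ 0 := Real.pi_ne_zero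
        have hm0 : m ≠ 0 := hm.ne'
        have hsm : Real.sqrt m ≠ 0 := (Real.sqrt_pos.2 hm).ne'
        field_simp

/-! ## §5. The TILT by a nonnegative almost-local operator: «G̃₃(x)» uniformly on `x ∈ [0, γ₁]` -/

omit [DecidableEq n] in
/-- Accretivity survives a nonnegative tilt (as `B13Sqrt27AccretiveSquare.accretive_add_smul_of_nonneg`). [folklore] -/
private theorem accretive_add_smul_of_nonneg' {T P : Matrix n n ℂ} {m : ℝ}
    (hacc : ∀ v : n → ℂ, m * ∑ i, ‖v i‖ ^ 2 ≤ (∑ i, star (v i) * (T *ᵥ v) i).re)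
    (hP : ∀ v : n → ℂ, 0 ≤ (∑ i, star (v i) * (P *ᵥ v) i).re) {x : ℝ} (hx : 0 ≤ x) (v : n → ℂ) :
    m * ∑ i, ‖v i‖ ^ 2 ≤ (∑ i, star (v i) * ((T + (x : ℂ) • P) *ᵥ v) i).re := by
  have hsplit : (∑ i, star (v i) * ((T + (x : ℂ) • P) *ᵥ v) i)
      = (∑ i, star (v i) * (T *ᵥ v) i) + (x : ℂ) * ∑ i, star (v i) * (P *ᵥ v) i := by
    simp only [Matrix.add_mulVec, Matrix.smul_mulVec, Pi.add_apply, Pi.smul_apply, smul_eq_mul, mul_add,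
      Finset.sum_add_distrib, Finset.mul_sum]
    congr 1
    exact Finset.sum_congr rfl fun i _ => by ring
  rw [hsplit, Complex.add_re, Complex.re_ofReal_mul]
  nlinarith [hacc v, hP v, mul_nonneg hx (hP v)]

/-- **THE ALMOST-LOCAL TILT, x-UNIFORM ON THE COMPACT RANGE** (print p. 13: *"This term determines a nonnegative,
bounded and almost local operator … The operator G̃₃(x) has the same properties as G̃₂"*): `T` `m`-accretive with
weighted sums `≤ ϱ_T`, `P` with `Re⟨v, Pv⟩ ≥ 0` and weighted sums `≤ ϱ_P` (*"almost local"* = exponentially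
localised at rate `κ`), and `ϱ_T + γ₁·ϱ_P ≤ m/2`; then for EVERY `x ∈ [0, γ₁]` the tilted kernel `T + x·P` is invertible
with `‖((T + x·P)⁻¹)_{ij}‖ ≤ (4/m)·e^{−κ·d(i,j)}` — one rate, one amplitude for the whole range.
[cite: Balaban1988RG2Cluster, (2.7) p.13, p.15] -/
theorem almostLocal_tilted_inverse_decay (d : n → n → ℝ) (hd0 : ∀ i, d i i = 0) (hds : ∀ i j, d i j = d j i)
    (hdt : ∀ i j k, d i k ≤ d i j + d j k) (T P : Matrix n n ℂ) {m κ ϱT ϱP γ₁ : ℝ} (hm : 0 < m) (hκ : 0 ≤ κ)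
    (hϱT : 0 ≤ ϱT) (hϱP : 0 ≤ ϱP) (hsum : ϱT + γ₁ * ϱP ≤ m / 2)
    (hacc : ∀ v : n → ℂ, m * ∑ i, ‖v i‖ ^ 2 ≤ (∑ i, star (v i) * (T *ᵥ v) i).re)
    (hPnn : ∀ v : n → ℂ, 0 ≤ (∑ i, star (v i) * (P *ᵥ v) i).re)
    (hrow : ∀ i, ∑ l, ‖T i l‖ * (Real.exp (κ * d i l) - 1) ≤ ϱT)
    (hcol : ∀ l, ∑ i, ‖T i l‖ * (Real.exp (κ * d i l) - 1) ≤ ϱT)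
    (hrowP : ∀ i, ∑ l, ‖P i l‖ * (Real.exp (κ * d i l) - 1) ≤ ϱP)
    (hcolP : ∀ l, ∑ i, ‖P i l‖ * (Real.exp (κ * d i l) - 1) ≤ ϱP) {x : ℝ} (hx : 0 ≤ x) (hxγ : x ≤ γ₁) :
    IsUnit (T + (x : ℂ) • P).det ∧
      ∀ i j, ‖(T + (x : ℂ) • P)⁻¹ i j‖ ≤ 4 / m * Real.exp (-(κ * d i j)) := by
  have hγ₁ : 0 ≤ γ₁ := hx.trans hxγ
  have hw : ∀ i l, ‖(T + (x : ℂ) • P) i l‖ * (Real.exp (κ * d i l) - 1)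
      ≤ ‖T i l‖ * (Real.exp (κ * d i l) - 1) + x * (‖P i l‖ * (Real.exp (κ * d i l) - 1)) := by
    intro i l
    have hd : 0 ≤ d i l := by
      have h := hdt i l i
      rw [hd0, hds l i] at h
      linarith
    have he : 0 ≤ Real.exp (κ * d i l) - 1 := sub_nonneg.2 (Real.one_le_exp (mul_nonneg hκ hd))
    have h1 : ‖(T + (x : ℂ) • P) i l‖ ≤ ‖T i l‖ + x * ‖P i l‖ := by
      rw [Matrix.add_apply, Matrix.smul_apply, smul_eq_mul]
      refine (norm_add_le _ _).trans ?_
      rw [norm_mul, Complex.norm_real, Real.norm_eq_abs, abs_of_nonneg hx]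
    nlinarith [mul_le_mul_of_nonneg_right h1 he]
  have hrowA : ∀ i, ∑ l, ‖(T + (x : ℂ) • P) i l‖ * (Real.exp (κ * d i l) - 1) ≤ ϱT + γ₁ * ϱP := fun i => by
    refine (Finset.sum_le_sum fun l _ => hw i l).trans ?_
    rw [Finset.sum_add_distrib, ← Finset.mul_sum]
    exact add_le_add (hrow i) ((mul_le_mul hxγ (hrowP i)
      (Finset.sum_nonneg fun l _ => by
        have hd : 0 ≤ d i l := by
          have h := hdt i l i
          rw [hd0, hds l i] at h
          linarith
        exact mul_nonneg (norm_nonneg _) (sub_nonneg.2 (Real.one_le_exp (mul_nonneg hκ hd)))) hγ₁))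
  have hcolA : ∀ l, ∑ i, ‖(T + (x : ℂ) • P) i l‖ * (Real.exp (κ * d i l) - 1) ≤ ϱT + γ₁ * ϱP := fun l => by
    refine (Finset.sum_le_sum fun i _ => hw i l).trans ?_
    rw [Finset.sum_add_distrib, ← Finset.mul_sum]
    exact add_le_add (hcol l) ((mul_le_mul hxγ (hcolP l)
      (Finset.sum_nonneg fun i _ => by
        have hd : 0 ≤ d i l := by
          have h := hdt i l i
          rw [hd0, hds l i] at h
          linarith
        exact mul_nonneg (norm_nonneg _) (sub_nonneg.2 (Real.one_le_exp (mul_nonneg hκ hd)))) hγ₁))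
  exact almostLocal_inverse_decay d hd0 hds hdt _ hm hκ (by positivity) hsum
    (accretive_add_smul_of_nonneg' hacc hPnn hx) hrowA hcolA

end Literature.MathematicalPhysics.QuantumFieldTheory.Balaban1983to89.B13Sqrt27AccretiveAlmostLocal

end
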